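import Literature.AnabelianGeometry.EtaleTheta.Discharge.Sec5RootOfRootModel

/-!
# [EtTh] Rmk. 4.3.2 / Prop. 5.2 (i) at the canonical model: the `N`-th root of the `l`-th root's pair, constructed;
# Prop. 5.2 (i) in BOTH printed alternatives for the constructed pair (GAP rows G-L2t4-1 / G-L2t4-1b)

Mochizuki, *The étale theta function and its Frobenioid-theoretic manifestations*, Publ. RIMS **45** (2009):
Rmk. 4.3.2 pp. 318–319 (PDF pp. 92–93); Prop. 5.2 (i) p. 324 (PDF p. 98) «The pair of morphisms of `C` determined
by "`s_{l·N}`", "`τ_{l·N}`" constitutes an `l·N`-th root of a right fraction-pair … of … the theta function `Θ̈` …,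
or, alternatively, an `N`-th root of a right fraction-pair … of … an `l`-th root of the theta function `Θ̈`
[cf. Remark 4.3.2]», proof: «the "(l·N, H_⊙, f|_{A_{l·N}})-saturated-ness" condition … follows immediately from
the definition of the field `J̈_{l·N}` in §1» [cite: MochizukiEtTh2009, Prop 5.2 (i) p.324 (PDF p.98)].

abc-iut cell, layer L2, PROOF-ONLY companion (0 `def`s; seat abc-iut-w5-d134 gen 4) of
`Discharge/Sec5RootOfRootModel.lean` (this seat: Prop. 4.2 (iii) over a general domain with a two-level covering,
`exists_nthRoot_twoLevel_mkOfModelCanonical`) and `Discharge/Sec5RootCompositionModel.lean` (this lineage,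
p427648: `pairIsNthRootOf_comp_mkOfModelCanonical`, the composite `l·N`-th root modulo the binders `hsk`, `hμ`,
`hcondA` on the `N`-domain — GAP rows G-L2t4-1 / G-L2t4-1b).  Consumer: abc-iut-L2-t4's §5 carrier over
`B^temp(Π^tp_X)⁰` (`thetaPairIsRoot_ofConnectedTemperoidData_of_comp`, p428578), whose datum
`R : S.NthRoot Rl.root Rl.pair N` is PRODUCED here.  Nothing landed is edited or restated.

* `exists_nthRoot_over_root_mkOfModelCanonical` — for an `l`-th root datum `Rl` of a right fraction-pair of
  `θ ∈ O^×(A_⊙^birat)` whose `l`-domain lies in a skeleton through `A_⊙` (L01′ clause) and whose root `f_l` is fixed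
  by `H_{A_l}` (without which the typed datum `R` cannot exist: `R.isSaturated.fixed`), an `N`-th root `R` of the
  root's pair with `hsk`, `hμ` (`μ_{l·N}`-saturation) and `hcondA` (Def. 4.1 (iii)(a) at level `l·N`) as THEOREMS.
* `exists_nthRoot_pairIsNthRootOf_mul_mkOfModelCanonical` — **[EtTh] Prop. 5.2 (i), both alternatives
  simultaneously for a constructed pair**: `(s^⊓_N, s^⊔_N) := R.pair` is an `l·N`-th root of `θ`'s pair and an
  `N`-th root of the `l`-th root's pair — modulo base-level laws only (`Φ` divisorial, `hDSpull`, `hR`, `hE₂`, `hS`).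

HONEST FRAMING: kernel-checked consequences of the named base-level laws for data so typed; nothing asserts that
such data exist for an actual curve; no side is taken on [IUTchIII] Cor. 3.12; typed ≠ proved for the laws.
-/

noncomputable section

namespace Literature.AnabelianGeometry.EtaleTheta

open CategoryTheory Opposite Literature.AlgebraicGeometry.Frobenioids

universe u₀ v₀ u v w

namespace BiKummerSetting

section Canonical

variable {K : Type u₀} [Field K] (X : SemiGraphs.TemperedArithmeticGroup.{u₀} K) {D₀ : Type u₀}
  [Category.{v₀} D₀] {V : FrdIMonoidStub.{w}} {T : RealifiedDivisorMonoids (D₀ := D₀) V}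
  {D : Type u} [Category.{v} D] {VD : FrdICatStub.{u, v, w} D}
  (tf : TemperedFrobenioid T D VD) (hZ : tf.monoidType = MonoidType.Z)
  (hP : ∀ A : Dᵒᵖ, IsPerfect (tf.Φ.carrier A)) (IG : D → Prop) (gS : ∀ A : D, IG A → (X.Pi →* Aut A))
  (gSs : ∀ (A : D) (h : IG A), Function.Surjective (gS A h))
  (NH : Subgroup (Field.absoluteGaloisGroup K) → tf.category → ℕ+ → Prop) (A₀ : tf.category)
  (hA₀ : PreFrobenioid.IsFrobeniusTrivial tf.toElem A₀) (hA₀' : IG A₀.base)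
  (hΦd : Objectwise (fun M _ => IsDivisorial M) tf.divisorMonoid)

include hΦd in
/-- **[EtTh] Rmk. 4.3.2 at the canonical model — the `N`-th root of the `l`-th root's pair, CONSTRUCTED with its
covering at level `l·N`** (GAP row G-L2t4-1b): for an `l`-th root datum `Rl` of a right fraction-pair `Pl` of
`θ ∈ O^×(A_⊙^birat)` whose `l`-domain `A_l` lies in a skeleton through `A_⊙` (`hskl`, the L01′ clause) and whose
root `f_l` is fixed by `H_{A_l}` (`hfixl`), there is an `N`-th root `R` of the root's pair over `A_l` such that
`A_N = A_⊙` whenever `A_N^bs ≅ A_⊙^bs` (`hsk`), `A_N` is `μ_{l·N}`-saturated (`hμ`) and satisfies Def. 4.1 (iii)(a)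
at level `l·N` (`hcondA`) — the three binders of `pairIsNthRootOf_comp_mkOfModelCanonical` (p427648) as theorems.
[cite: MochizukiEtTh2009, Rmk 4.3.2 p.318–319 (PDF pp.92–93)] -/
theorem exists_nthRoot_over_root_mkOfModelCanonical
    (hDSpull : ∀ {A A' : D} (e : A' ⟶ A) {a b : tf.Φ.carrier (op A)},
      (∀ x : tf.Φ.carrier (op A), x ∣ a → x ∣ b → x = 1) →
        ∀ y : tf.Φ.carrier (op A'), y ∣ pull tf.divisorMonoid e a → y ∣ pull tf.divisorMonoid e b → y = 1)
    (hR : ∀ (N : ℕ+) (A : D), IG A → ∀ f : tf.ratFnFunctor.obj (op A),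
      ∃ (A' : D) (_ : IG A') (b : A' ⟶ A) (g : tf.ratFnFunctor.obj (op A')),
        g ^ (N : ℕ) = pull tf.ratFnFunctor b f)
    (hE₂ : ∀ (N M : ℕ+), (N : ℕ) ∣ (M : ℕ) → ∀ (A' : tf.category),
      PreFrobenioid.IsFrobeniusTrivial tf.toElem A' → IG A'.base →
      ∃ (A'' : tf.category) (ψ : A'' ⟶ A'), PreFrobenioid.IsPullbackMorphism tf.toElem ψ ∧ IG A''.base ∧
        tf.IsMuSaturated A'' M ∧
          NH (mkOfModelCanonical X tf hZ hP IG gS gSs NH A₀ hA₀ hA₀').HodotBsFld A'' M ∧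
            NH (mkOfModelCanonical X tf hZ hP IG gS gSs NH A₀ hA₀ hA₀').HodotBsFld A'' N)
    (hS : ∀ ⦃A B : D⦄ (hA : IG A) (hB : IG B) (b : B ⟶ A),
      ∃ c : X.Pi, ∀ g : X.Pi, (gS B hB g).hom ≫ b = b ≫ (gS A hA (c * g * c⁻¹)).hom)
    {Bl : tf.category} {θ : tf.biratUnitsModel A₀}
    {Pl : (mkOfModelCanonical X tf hZ hP IG gS gSs NH A₀ hA₀ hA₀').FractionPair θ Bl} {lv : ℕ+}
    (Rl : (mkOfModelCanonical X tf hZ hP IG gS gSs NH A₀ hA₀ hA₀').NthRoot θ Pl lv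
      (fun {_} φ x => tf.pullFracModel φ x))
    (hskl : Nonempty (Rl.AN.base ≅ A₀.base) → Rl.AN = A₀)
    (hfixl : (mkOfModelCanonical X tf hZ hP IG gS gSs NH A₀ hA₀ hA₀').IsFixedByHA Rl.AN Rl.αData.isGalois Rl.root)
    (N : ℕ+) :
    ∃ R : (mkOfModelCanonical X tf hZ hP IG gS gSs NH A₀ hA₀ hA₀').NthRoot Rl.root Rl.pair N
        (fun {_} φ x => tf.pullFracModel φ x),
      (Nonempty (R.AN.base ≅ A₀.base) → R.AN = A₀) ∧ tf.IsMuSaturated R.AN (lv * N) ∧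
        ∃ (A' A'' : tf.category) (s₁ : A' ⟶ R.AN) (s₂ : A' ⟶ A''),
          (mkOfModelCanonical X tf hZ hP IG gS gSs NH A₀ hA₀ hA₀').IsPreStep s₁ ∧
            (mkOfModelCanonical X tf hZ hP IG gS gSs NH A₀ hA₀ hA₀').IsPreStep s₂ ∧
              (mkOfModelCanonical X tf hZ hP IG gS gSs NH A₀ hA₀ hA₀').IsFrobeniusTrivial A'' ∧
                (mkOfModelCanonical X tf hZ hP IG gS gSs NH A₀ hA₀ hA₀').IsNHSaturatedBsFld
                  (mkOfModelCanonical X tf hZ hP IG gS gSs NH A₀ hA₀ hA₀').HodotBsFld A'' (lv * N) :=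
  exists_nthRoot_twoLevel_mkOfModelCanonical X tf hZ hP IG gS gSs NH A₀ hA₀ hA₀' hΦd hDSpull hR hE₂ hS
    Rl.αData.isFrobeniusTrivial Rl.αData.isGalois hskl hfixl Rl.pair N (lv * N)
    (by rw [PNat.mul_coe]; exact Dvd.intro_left _ rfl)

include hΦd in
/-- **[EtTh] Prop. 5.2 (i), BOTH printed alternatives simultaneously, for a CONSTRUCTED pair** at the canonical
model, modulo base-level laws only: for `θ = Θ̈ ∈ O^×(A_⊙^birat)` with an `l`-th root datum `Rl` (`l`-domain in a
skeleton through `A_⊙`, root fixed by `H_{A_l}`), there is an `N`-th root `R` of the `l`-th root's pair whose root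
pair `(s^⊓_N, s^⊔_N)` «constitutes an `l·N`-th root of a right fraction-pair of `Θ̈` … or, alternatively, an
`N`-th root of a right fraction-pair of an `l`-th root of `Θ̈`» — the first by this lineage's
`pairIsNthRootOf_comp_mkOfModelCanonical` (GAP G-L2t4-1, p427648) whose binders `hsk`, `hμ`, `hcondA` are now
supplied by `exists_nthRoot_over_root_mkOfModelCanonical`, the second by construction.
[cite: MochizukiEtTh2009, Prop 5.2 (i) p.324 (PDF p.98)] -/
theorem exists_nthRoot_pairIsNthRootOf_mul_mkOfModelCanonical
    (hDSpull : ∀ {A A' : D} (e : A' ⟶ A) {a b : tf.Φ.carrier (op A)},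
      (∀ x : tf.Φ.carrier (op A), x ∣ a → x ∣ b → x = 1) →
        ∀ y : tf.Φ.carrier (op A'), y ∣ pull tf.divisorMonoid e a → y ∣ pull tf.divisorMonoid e b → y = 1)
    (hR : ∀ (N : ℕ+) (A : D), IG A → ∀ f : tf.ratFnFunctor.obj (op A),
      ∃ (A' : D) (_ : IG A') (b : A' ⟶ A) (g : tf.ratFnFunctor.obj (op A')),
        g ^ (N : ℕ) = pull tf.ratFnFunctor b f)
    (hE₂ : ∀ (N M : ℕ+), (N : ℕ) ∣ (M : ℕ) → ∀ (A' : tf.category),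
      PreFrobenioid.IsFrobeniusTrivial tf.toElem A' → IG A'.base →
      ∃ (A'' : tf.category) (ψ : A'' ⟶ A'), PreFrobenioid.IsPullbackMorphism tf.toElem ψ ∧ IG A''.base ∧
        tf.IsMuSaturated A'' M ∧
          NH (mkOfModelCanonical X tf hZ hP IG gS gSs NH A₀ hA₀ hA₀').HodotBsFld A'' M ∧
            NH (mkOfModelCanonical X tf hZ hP IG gS gSs NH A₀ hA₀ hA₀').HodotBsFld A'' N)
    (hS : ∀ ⦃A B : D⦄ (hA : IG A) (hB : IG B) (b : B ⟶ A),
      ∃ c : X.Pi, ∀ g : X.Pi, (gS B hB g).hom ≫ b = b ≫ (gS A hA (c * g * c⁻¹)).hom)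
    {Bl : tf.category} {θ : tf.biratUnitsModel A₀}
    {Pl : (mkOfModelCanonical X tf hZ hP IG gS gSs NH A₀ hA₀ hA₀').FractionPair θ Bl} {lv : ℕ+}
    (Rl : (mkOfModelCanonical X tf hZ hP IG gS gSs NH A₀ hA₀ hA₀').NthRoot θ Pl lv
      (fun {_} φ x => tf.pullFracModel φ x))
    (hskl : Nonempty (Rl.AN.base ≅ A₀.base) → Rl.AN = A₀)
    (hfixl : (mkOfModelCanonical X tf hZ hP IG gS gSs NH A₀ hA₀ hA₀').IsFixedByHA Rl.AN Rl.αData.isGalois Rl.root)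
    (N : ℕ+) :
    ∃ R : (mkOfModelCanonical X tf hZ hP IG gS gSs NH A₀ hA₀ hA₀').NthRoot Rl.root Rl.pair N
        (fun {_} φ x => tf.pullFracModel φ x),
      (mkOfModelCanonical X tf hZ hP IG gS gSs NH A₀ hA₀ hA₀').PairIsNthRootOf (fun {_ _} φ x => tf.pullFracModel φ x)
          ((lv : ℕ) * N) θ R.pair.num R.pair.den ∧
        (mkOfModelCanonical X tf hZ hP IG gS gSs NH A₀ hA₀ hA₀').PairIsNthRootOf (fun {_ _} φ x => tf.pullFracModel φ x)
          (N : ℕ) Rl.root R.pair.num R.pair.den := by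
  obtain ⟨R, hsk, hμ, hcondA⟩ := exists_nthRoot_over_root_mkOfModelCanonical X tf hZ hP IG gS gSs NH A₀ hA₀ hA₀' hΦd
    hDSpull hR hE₂ hS Rl hskl hfixl N
  exact ⟨R, pairIsNthRootOf_comp_mkOfModelCanonical X tf hZ hP IG gS gSs NH A₀ hA₀ hA₀' hΦd Rl R hsk hμ hcondA,
    (mkOfModelCanonical X tf hZ hP IG gS gSs NH A₀ hA₀ hA₀').pairIsNthRootOf_nthRoot
      (fun {_ _} φ x => tf.pullFracModel φ x) R⟩


include hΦd in
/-- **The two-level refinement law `hE₂` from the one-level law and upward persistence** (v2, append-only): the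
[FrdII] Rmk. 2.2.1 refinement law `hE` of abc-iut-w4-d044's closers (GAP G-w4d044-2, verbatim shape) together with
the persistence of `(N, H_⊙^{bs-fld})`-saturation along pull-back morphisms with Galois source (`hUp`; at the
arithmetic binding: saturation of `(L, O^□_L)` persists under finite Galois enlargement `L ⊆ L′`, by
inflation–restriction) give the joint law `hE₂` of `exists_nthRoot_twoLevel_mkOfModelCanonical` (GAP
G-w5d134g4-1): refine at level `N` first, then at level `M`, and carry the level-`N` saturation up.  The
divisibility premise is not used.  [cite: MochizukiFrdII2008, Rmk 2.2.1 p.18] -/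
theorem twoLevel_refinement_of_persistence
    (hE : ∀ (N : ℕ+) (A' : tf.category), PreFrobenioid.IsFrobeniusTrivial tf.toElem A' → IG A'.base →
      ∃ (A'' : tf.category) (ψ : A'' ⟶ A'), PreFrobenioid.IsPullbackMorphism tf.toElem ψ ∧ IG A''.base ∧
        tf.IsMuSaturated A'' N ∧ NH (mkOfModelCanonical X tf hZ hP IG gS gSs NH A₀ hA₀ hA₀').HodotBsFld A'' N)
    (hUp : ∀ (N : ℕ+) {A' A'' : tf.category} (ψ : A'' ⟶ A'), PreFrobenioid.IsPullbackMorphism tf.toElem ψ →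
      PreFrobenioid.IsFrobeniusTrivial tf.toElem A' → IG A'.base → IG A''.base →
      NH (mkOfModelCanonical X tf hZ hP IG gS gSs NH A₀ hA₀ hA₀').HodotBsFld A' N →
        NH (mkOfModelCanonical X tf hZ hP IG gS gSs NH A₀ hA₀ hA₀').HodotBsFld A'' N) :
    ∀ (N M : ℕ+), (N : ℕ) ∣ (M : ℕ) → ∀ (A' : tf.category),
      PreFrobenioid.IsFrobeniusTrivial tf.toElem A' → IG A'.base →
      ∃ (A'' : tf.category) (ψ : A'' ⟶ A'), PreFrobenioid.IsPullbackMorphism tf.toElem ψ ∧ IG A''.base ∧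
        tf.IsMuSaturated A'' M ∧
          NH (mkOfModelCanonical X tf hZ hP IG gS gSs NH A₀ hA₀ hA₀').HodotBsFld A'' M ∧
            NH (mkOfModelCanonical X tf hZ hP IG gS gSs NH A₀ hA₀ hA₀').HodotBsFld A'' N := by
  have hBg := tf.isGroupLike_ratFnFunctor T.isUnit_BΛ
  intro N M _ A' hft hG
  obtain ⟨A₁, ψ₁, hψ₁, hG₁, -, hN₁⟩ := hE N A' hft hG
  have hft₁ : PreFrobenioid.IsFrobeniusTrivial tf.toElem A₁ :=
    (mkOfModelCanonical X tf hZ hP IG gS gSs NH A₀ hA₀ hA₀').isFrobeniusTrivial_of_isPullback hΦd hBg hψ₁ hft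
  obtain ⟨A₂, ψ₂, hψ₂, hG₂, hμ₂, hM₂⟩ := hE M A₁ hft₁ hG₁
  exact ⟨A₂, ψ₂ ≫ ψ₁, (mkOfModelCanonical X tf hZ hP IG gS gSs NH A₀ hA₀ hA₀').isPullback_comp hΦd hBg hψ₂ hψ₁, hG₂,
    hμ₂, hM₂, hUp N ψ₂ hψ₂ hft₁ hG₁ hG₂ hN₁⟩

include hΦd in
/-- **[EtTh] Prop. 5.2 (i), both alternatives, with the refinement law in its ONE-LEVEL form plus persistence**
(v2): `exists_nthRoot_pairIsNthRootOf_mul_mkOfModelCanonical` fed with `twoLevel_refinement_of_persistence`.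
[cite: MochizukiEtTh2009, Prop 5.2 (i) p.324 (PDF p.98)] -/
theorem exists_nthRoot_pairIsNthRootOf_mul_mkOfModelCanonical_of_persistence
    (hDSpull : ∀ {A A' : D} (e : A' ⟶ A) {a b : tf.Φ.carrier (op A)},
      (∀ x : tf.Φ.carrier (op A), x ∣ a → x ∣ b → x = 1) →
        ∀ y : tf.Φ.carrier (op A'), y ∣ pull tf.divisorMonoid e a → y ∣ pull tf.divisorMonoid e b → y = 1)
    (hR : ∀ (N : ℕ+) (A : D), IG A → ∀ f : tf.ratFnFunctor.obj (op A),
      ∃ (A' : D) (_ : IG A') (b : A' ⟶ A) (g : tf.ratFnFunctor.obj (op A')),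
        g ^ (N : ℕ) = pull tf.ratFnFunctor b f)
    (hE : ∀ (N : ℕ+) (A' : tf.category), PreFrobenioid.IsFrobeniusTrivial tf.toElem A' → IG A'.base →
      ∃ (A'' : tf.category) (ψ : A'' ⟶ A'), PreFrobenioid.IsPullbackMorphism tf.toElem ψ ∧ IG A''.base ∧
        tf.IsMuSaturated A'' N ∧ NH (mkOfModelCanonical X tf hZ hP IG gS gSs NH A₀ hA₀ hA₀').HodotBsFld A'' N)
    (hUp : ∀ (N : ℕ+) {A' A'' : tf.category} (ψ : A'' ⟶ A'), PreFrobenioid.IsPullbackMorphism tf.toElem ψ →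
      PreFrobenioid.IsFrobeniusTrivial tf.toElem A' → IG A'.base → IG A''.base →
      NH (mkOfModelCanonical X tf hZ hP IG gS gSs NH A₀ hA₀ hA₀').HodotBsFld A' N →
        NH (mkOfModelCanonical X tf hZ hP IG gS gSs NH A₀ hA₀ hA₀').HodotBsFld A'' N)
    (hS : ∀ ⦃A B : D⦄ (hA : IG A) (hB : IG B) (b : B ⟶ A),
      ∃ c : X.Pi, ∀ g : X.Pi, (gS B hB g).hom ≫ b = b ≫ (gS A hA (c * g * c⁻¹)).hom)
    {Bl : tf.category} {θ : tf.biratUnitsModel A₀}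
    {Pl : (mkOfModelCanonical X tf hZ hP IG gS gSs NH A₀ hA₀ hA₀').FractionPair θ Bl} {lv : ℕ+}
    (Rl : (mkOfModelCanonical X tf hZ hP IG gS gSs NH A₀ hA₀ hA₀').NthRoot θ Pl lv
      (fun {_} φ x => tf.pullFracModel φ x))
    (hskl : Nonempty (Rl.AN.base ≅ A₀.base) → Rl.AN = A₀)
    (hfixl : (mkOfModelCanonical X tf hZ hP IG gS gSs NH A₀ hA₀ hA₀').IsFixedByHA Rl.AN Rl.αData.isGalois Rl.root)
    (N : ℕ+) :
    ∃ R : (mkOfModelCanonical X tf hZ hP IG gS gSs NH A₀ hA₀ hA₀').NthRoot Rl.root Rl.pair N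
        (fun {_} φ x => tf.pullFracModel φ x),
      (mkOfModelCanonical X tf hZ hP IG gS gSs NH A₀ hA₀ hA₀').PairIsNthRootOf (fun {_ _} φ x => tf.pullFracModel φ x)
          ((lv : ℕ) * N) θ R.pair.num R.pair.den ∧
        (mkOfModelCanonical X tf hZ hP IG gS gSs NH A₀ hA₀ hA₀').PairIsNthRootOf (fun {_ _} φ x => tf.pullFracModel φ x)
          (N : ℕ) Rl.root R.pair.num R.pair.den :=
  exists_nthRoot_pairIsNthRootOf_mul_mkOfModelCanonical X tf hZ hP IG gS gSs NH A₀ hA₀ hA₀' hΦd hDSpull hR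
    (twoLevel_refinement_of_persistence X tf hZ hP IG gS gSs NH A₀ hA₀ hA₀' hΦd hE hUp) hS Rl hskl hfixl N

end Canonical

end BiKummerSetting

end Literature.AnabelianGeometry.EtaleTheta

end
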